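import Summits.Ventures.HSemireg.WedgePointPairPowersKernelSpan

/-!
# Venture HSemireg — C4 / C10's kernel NAME in EVERY degree for the `n`-fold box of `m`-dimensional point pairs:
# `ker(θ ↦ θ ∧ F) = span{killed monomials} ⊕ span{collapse binomials}` (every `m ≥ 1`, `n`, `k`)

HONEST FRAMING. Part of the Lean index of the computation cell `pub-hsemireg` (seat p10 gen 7, Sunday typer «UNIFORM-IN-n»).
Finite-dimensional EXTERIOR ALGEBRA over a field ONLY: no variety, no cohomology theory, no sheaf, no Ext group and no
semiregularity map is constructed here; nothing here says that HC / HC_CM / HC_AV holds; no Literature fact is declared or used.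
Custodian versions cited: STRUCTURE.md v1.0-SIGNED 9b196a05977dd067 §1.1 C4 (kernel NAME) and C10 («family A plain … 8n²−7n / 5n;
ker = ⊕_i [H¹(T_{S_i}) ⊕ collapsed line (σ̄₀,0,η₀)_i]»); theory/FORMULA-N.md PART A §2.2 / §8 F-2 («top-line collapse»: the
corrections `−1 − tⁿ` of `P_n = 2(1+t)ⁿ − 1 − tⁿ`).

p10 gen 6 (`WedgePointPairPowersKernelSpan.lean`) named the kernel BELOW the factor dimension (`k < m`: the span of the KILLED
monomials, a block part meeting both halves).  THIS FILE removes the restriction `k < m` (same model: generators `Fin ((m+m)·n)` in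
`n` blocks `X_i ⊔ Y_i`, box `F = Π_i (a·E_{X_i} + c·E_{Y_i})`, `θ ↦ θ ∧ F` on `⋀^k`):
* §1 `canon s`: the CANONICAL REPRESENTATIVE of `E_s` — every block part equal to the full half `Y_i` is traded for the full half
  `X_i` (the TOP COLLAPSE `E_{Y_i} ∧ f_i ∝ E_{X_i} ∧ f_i ∝ E_{X_i ⊔ Y_i}`); the alive `k`-sets split into CANONICAL ones (`canonSet`,
  no block part `Y_i`; in bijection with th-7's canonical source families `Kset m n k`, so **`card_canonSet`: `#canonical = [t^k]P_mⁿ`**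
  `= rank`) and COLLAPSED ones (`collapsedSet`, some block part `Y_i`);
* §2 **`B_mul_pairBox_eq_smul_canon`**: `E_s ∧ F = λ_s·E_{canon s} ∧ F`, `λ_s ≠ 0` (block by block, then th-7's ordered product of
  local images); the COLLAPSE COEFFICIENT `ccoef` (`λ_s`, CHOSEN by this property; only `λ_s ≠ 0` is proved and used) and the COLLAPSE
  BINOMIAL `binom s = E_s − λ_s·E_{canon s}`, annihilated by `F` (`binom_mul_pairBox`);
* §3 `linearIndependent_killed_binom`: killed monomials and collapse binomials of collapsed sets are linearly independent;
* §4 MAIN THEOREM **`map_ker_wedge_pairBox_eq_span_killed_sup_binom`** (every field, `m ≥ 1`, `n`, `k`, `a, c ≠ 0`):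
  `ker(θ ↦ θ ∧ F ∣ ⋀^k K^{(m+m)n}) = span{E_s : s killed} ⊔ span{E_s − λ_s E_{canon s} : s collapsed}` (direct by §3);
  **`finrank_ker_wedge_pairBox_all`**: `dim ker = #killed + #collapsed` (`= C((m+m)n, k) − [t^k]P_mⁿ`, the closed count of the
  definition-free leaf `WedgePointPairPowersKernelDim.finrank_ker_wedge_pairBox_every_degree`);
* §5 WHERE THE COLLAPSES LIVE: none below degree `m` (`collapsedSet_eq_empty_of_lt`, gen 6's case); in degree `m` exactly the `n`
  full halves `E_{Y_i}` (`collapsedSet_self_eq_image`, `card_collapsedSet_self`), so **`finrank_ker_wedge_pairBox_self`**: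
  `dim ker(⋀^m) = #killed + n` — ONE COLLAPSED LINE `E_{Y_i} − λ·E_{X_i}` PER FACTOR; SURFACES (`m = 2`, degree 2):
  **`ker_wedge_pairBox_two_surface_named`** `dim ker = 4n + n` (the `4n` split pairs `x ∧ y` and the `n` collapsed lines
  `y_{i1}y_{i2} − λ·x_{i1}x_{i2}`) — in the quoted dictionary (`X_i ↔ H⁰(T)`-, `Y_i ↔ H¹(𝒪)`-type directions; NOT asserted)
  STRUCTURE C10's «⊕_i [H¹(T_{S_i}) ⊕ collapsed line]», `5n`, and FORMULA-N's «top-line collapse» AS KERNEL VECTORS.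
NOT here: the Ext side; per-`q` refinements of the kernel.  Namespace `Summit.Ventures.HSemireg.Wedge.PairPowers`; new names only.
-/


open Module Set Set.powersetCard Polynomial

namespace Summit.Ventures.HSemireg.Wedge.PairPowers

open Summit.Ventures.HSemireg.Wedge Summit.Ventures.HSemireg.Wedge.Kunneth

variable (K : Type*) [Field K] {m n : ℕ}

/-! ## §1. Alive sets, canonical representatives, canonical and collapsed sets -/

/-- the CANONICAL REPRESENTATIVE of `s`: every block part equal to the full half `Y_i` is replaced by the full half `X_i`. -/
def canon (s : Finset (Fin ((m + m) * n))) : Finset (Fin ((m + m) * n)) :=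
  glue fun i => if pb m n i s = Ys m then Xs m else pb m n i s

/-- block parts of the canonical representative. -/
lemma pb_canon (s : Finset (Fin ((m + m) * n))) (i : Fin n) :
    pb m n i (canon s) = if pb m n i s = Ys m then Xs m else pb m n i s := by
  unfold canon
  rw [pb_glue]

/-- the canonical representative has the same number of letters. -/
lemma card_canon (s : Finset (Fin ((m + m) * n))) : (canon s).card = s.card := by
  rw [card_eq_sum_card_pb (canon s), card_eq_sum_card_pb s]
  refine Finset.sum_congr rfl fun i _ => ?_
  rw [pb_canon]
  split_ifs with h
  · rw [h, WedgePair.card_Xset, WedgePair.card_Yset]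
  · rfl

/-- a monomial is determined by its block parts. -/
lemma eq_of_pb_eq {s t : Finset (Fin ((m + m) * n))} (h : ∀ i, pb m n i s = pb m n i t) : s = t := by
  rw [← biUnion_lift_pb s, ← biUnion_lift_pb t]
  exact Finset.biUnion_congr rfl fun i _ => by rw [h i]

/-- the canonical representative of an alive set is alive. -/
lemma alive_canon {s : Finset (Fin ((m + m) * n))} (hs : ∀ i : Fin n, Disjoint (pb m n i s) (Ys m) ∨ Disjoint (pb m n i s) (Xs m)) :
    ∀ i : Fin n, Disjoint (pb m n i (canon s)) (Ys m) ∨ Disjoint (pb m n i (canon s)) (Xs m) := fun i => by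
  rw [pb_canon]
  split_ifs
  · exact Or.inl (WedgePair.disjoint_XY m)
  · exact hs i

/-- no block part of a canonical representative is the half `Y` (`m ≥ 1`). -/
lemma pb_canon_ne_Ys (hm : 1 ≤ m) (s : Finset (Fin ((m + m) * n))) (i : Fin n) : pb m n i (canon s) ≠ Ys m := by
  rw [pb_canon]
  split_ifs with h
  · exact Xs_ne_Ys hm
  · exact h

/-- an alive block part other than the half `Y` is a canonical local source. -/
lemma mem_optSet_of_alive_ne {t : Finset (Fin (m + m))} (ht : Disjoint t (Ys m) ∨ Disjoint t (Xs m)) (hne : t ≠ Ys m) :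
    t ∈ optSet m := by
  rw [mem_optSet]
  rcases ht with hY | hX
  · exact Or.inl (WedgePair.disjoint_Y_iff_subset_X.mp hY)
  · by_cases h0 : t = ∅
    · exact Or.inl (h0 ▸ Finset.empty_subset _)
    · have hsub : t ⊆ Ys m := WedgePair.disjoint_X_iff_subset_Y.mp hX
      refine Or.inr ⟨hsub, Finset.card_pos.mpr (Finset.nonempty_iff_ne_empty.mpr h0), ?_⟩
      simpa only [WedgePair.card_Yset] using Finset.card_lt_card (Finset.ssubset_iff_subset_ne.mpr ⟨hsub, hne⟩)

/-- a canonical local source is not the half `Y` (`m ≥ 1`). -/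
lemma ne_Ys_of_mem_optSet (hm : 1 ≤ m) {t : Finset (Fin (m + m))} (ht : t ∈ optSet m) : t ≠ Ys m := by
  rintro rfl
  rcases mem_optSet.mp ht with hX | ⟨-, -, hlt⟩
  · have h0 : (⟨m, by omega⟩ : Fin (m + m)) ∈ Ys m := by rw [WedgePair.mem_Yset]
    have h1 := hX h0
    rw [WedgePair.mem_Xset] at h1
    simp at h1
  · rw [WedgePair.card_Yset] at hlt
    exact lt_irrefl _ hlt

variable (m n)

/-- the CANONICAL alive `k`-sets: no block part is the half `Y_i`. -/
def canonSet (k : ℕ) : Finset (Finset (Fin ((m + m) * n))) := (aliveSet m n k).filter fun s => ∀ i : Fin n, pb m n i s ≠ Ys m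

/-- the COLLAPSED alive `k`-sets: some block part is the full half `Y_i`. -/
def collapsedSet (k : ℕ) : Finset (Finset (Fin ((m + m) * n))) :=
  (aliveSet m n k).filter fun s => ¬ ∀ i : Fin n, pb m n i s ≠ Ys m

variable {m n}

/-- membership in `canonSet`. -/
lemma mem_canonSet {k : ℕ} {s : Finset (Fin ((m + m) * n))} : s ∈ canonSet m n k ↔
      (s.card = k ∧ ∀ i : Fin n, Disjoint (pb m n i s) (Ys m) ∨ Disjoint (pb m n i s) (Xs m)) ∧ ∀ i : Fin n, pb m n i s ≠ Ys m := by
  rw [canonSet, Finset.mem_filter, mem_aliveSet]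

/-- membership in `collapsedSet`. -/
lemma mem_collapsedSet {k : ℕ} {s : Finset (Fin ((m + m) * n))} : s ∈ collapsedSet m n k ↔
      (s.card = k ∧ ∀ i : Fin n, Disjoint (pb m n i s) (Ys m) ∨ Disjoint (pb m n i s) (Xs m)) ∧ ¬ ∀ i : Fin n, pb m n i s ≠ Ys m := by
  rw [collapsedSet, Finset.mem_filter, mem_aliveSet]

/-- `#canonical + #collapsed = #alive`. -/
lemma card_canonSet_add_card_collapsedSet (k : ℕ) :
    (canonSet m n k).card + (collapsedSet m n k).card = (aliveSet m n k).card :=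
  Finset.card_filter_add_card_filter_not _

/-- **the canonical alive `k`-sets are in bijection with th-7's canonical source families of degree `k`** (every `k`; `m ≥ 1`):
block `i ↦` its block part (a canonical local source), inverse `src`. -/
theorem card_canonSet_eq_card_Kset (hm : 1 ≤ m) (k : ℕ) : (canonSet m n k).card = (Kset m n k).card := by
  refine Finset.card_bij' (fun s hs i => ⟨pb m n i s, mem_optSet_of_alive_ne ((mem_canonSet.mp hs).1.2 i) ((mem_canonSet.mp hs).2 i)⟩)
    (fun f _ => src f) (fun s hs => ?_) (fun f hf => ?_) (fun s _ => ?_) (fun f _ => ?_)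
  · rw [mem_Kset, kf]
    show ∑ i, (pb m n i s).card = k
    rw [← card_eq_sum_card_pb s]
    exact (mem_canonSet.mp hs).1.1
  · rw [mem_canonSet, ← kf_eq_card_src, mem_Kset.mp hf]
    exact ⟨⟨rfl, fun i => by rw [pb_src]; exact alive_of_mem_optSet (f i).2⟩,
      fun i => by rw [pb_src]; exact ne_Ys_of_mem_optSet hm (f i).2⟩
  · exact biUnion_lift_pb s
  · funext i
    exact Subtype.ext (pb_src f i)

/-- **`#canonical alive k-sets = [t^k] P_m(t)ⁿ`** `= rank(θ ↦ θ ∧ F ∣ ⋀^k)` (every `k`, `m ≥ 1`; `card_Kset`). -/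
theorem card_canonSet (hm : 1 ≤ m) (k : ℕ) : (canonSet m n k).card = (pairPoly m ^ n).coeff k := by
  rw [card_canonSet_eq_card_Kset hm, card_Kset hm]

/-! ## §2. Every monomial image is a non-zero multiple of the image of its canonical representative -/

/-- the TOP COLLAPSE of one block: `E_Y ∧ (a E_X + c E_Y) = ν · E_X ∧ (a E_X + c E_Y)` with `ν = a·u(Y,X)·(c·u(X,Y))⁻¹ ≠ 0`. -/
lemma B_Ys_mul_pp (hm : 1 ≤ m) {a c : K} (ha : a ≠ 0) (hc : c ≠ 0) :
    ∃ ν : K, ν ≠ 0 ∧ B K (Fin (m + m)) (Ys m) * pp K m a c = ν • (B K (Fin (m + m)) (Xs m) * pp K m a c) := by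
  have hXY : Disjoint (Xs m) (Ys m) := WedgePair.disjoint_XY m
  have hne : ∀ {t : Finset (Fin (m + m))}, t.card = m → ¬ Disjoint t t := fun ht h => by
    rw [disjoint_self.mp h, Finset.bot_eq_empty, Finset.card_empty] at ht
    omega
  have hXX := hne (WedgePair.card_Xset (n := m))
  have hYY := hne (WedgePair.card_Yset (n := m))
  refine ⟨a * u K (Ys m) (Xs m) * (c * u K (Xs m) (Ys m))⁻¹,
    mul_ne_zero (mul_ne_zero ha ((u_ne_zero_iff K).mpr hXY.symm)) (inv_ne_zero (mul_ne_zero hc ((u_ne_zero_iff K).mpr hXY))), ?_⟩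
  rw [B_mul_pp, B_mul_pp, u_eq_zero K hYY, u_eq_zero K hXX, mul_zero, zero_smul, add_zero, mul_zero, zero_smul, zero_add,
    smul_smul, Finset.union_comm (Ys m) (Xs m), inv_mul_cancel_right₀ (mul_ne_zero hc ((u_ne_zero_iff K).mpr hXY))]

/-- proportional local images with NON-ZERO ratios give proportional ordered products with a non-zero ratio. -/
lemma lprod_smul_of_limg_ne_zero (a c : K) (s s' : Finset (Fin ((m + m) * n))) (ν : Fin n → K) (hν : ∀ i, ν i ≠ 0)
    (h : ∀ i, limg K a c s i = ν i • limg K a c s' i) : ∀ j, ∃ Λ : K, Λ ≠ 0 ∧ lprod K a c s j = Λ • lprod K a c s' j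
  | 0 => ⟨1, one_ne_zero, by rw [one_smul]; rfl⟩
  | j + 1 => by
    obtain ⟨Λ, hΛ, e⟩ := lprod_smul_of_limg_ne_zero a c s s' ν hν h j
    by_cases hj : j < n
    · refine ⟨Λ * ν ⟨j, hj⟩, mul_ne_zero hΛ (hν _), ?_⟩
      rw [lprod_succ K a c s hj, lprod_succ K a c s' hj, e, h, smul_mul_smul_comm]
    · exact ⟨Λ, hΛ, by rw [lprod_succ_of_le K a c s (by omega), lprod_succ_of_le K a c s' (by omega), e]⟩

/-- **`E_s ∧ F = λ_s · E_{canon s} ∧ F` with `λ_s ≠ 0`** (every `s`; `m ≥ 1`, `a, c ≠ 0`): collapse block by block, then multiply. -/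
theorem B_mul_pairBox_eq_smul_canon (hm : 1 ≤ m) {a c : K} (ha : a ≠ 0) (hc : c ≠ 0) (s : Finset (Fin ((m + m) * n))) :
    ∃ μ : K, μ ≠ 0 ∧ B K (Fin ((m + m) * n)) s * pairBox K (m := m) (n := n) a c =
      μ • (B K (Fin ((m + m) * n)) (canon s) * pairBox K (m := m) (n := n) a c) := by
  obtain ⟨ν, hν, eν⟩ := B_Ys_mul_pp K hm ha hc
  have hloc : ∀ i, limg K a c s i = (if pb m n i s = Ys m then ν else 1) • limg K a c (canon s) i := by
    intro i
    rw [limg_eq_emb, limg_eq_emb, pb_canon]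
    split_ifs with h
    · rw [h, eν, map_smul]
    · rw [one_smul]
  obtain ⟨Λ, hΛ, eΛ⟩ := lprod_smul_of_limg_ne_zero K a c s (canon s) _
    (fun i => by split_ifs; exacts [hν, one_ne_zero]) hloc n
  obtain ⟨μ, hμ, e⟩ := B_mul_pairBox K hm ha hc s
  obtain ⟨μ', hμ', e'⟩ := B_mul_pairBox K hm ha hc (canon s)
  refine ⟨μ * Λ * μ'⁻¹, mul_ne_zero (mul_ne_zero hμ hΛ) (inv_ne_zero hμ'), ?_⟩
  rw [e, eΛ, e', smul_smul, smul_smul, mul_assoc (μ * Λ), inv_mul_cancel₀ hμ', mul_one]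

open scoped Classical in
/-- the COLLAPSE COEFFICIENT `λ_s` of `s`: a non-zero scalar with `E_s ∧ F = λ_s · E_{canon s} ∧ F`, CHOSEN by that property (`Exists.choose`;
by hand it is `±(a/c)^{#collapsed blocks}`, which is neither proved nor used). -/
noncomputable def ccoef (a c : K) (s : Finset (Fin ((m + m) * n))) : K :=
  if h : ∃ μ : K, μ ≠ 0 ∧ B K (Fin ((m + m) * n)) s * pairBox K (m := m) (n := n) a c =
      μ • (B K (Fin ((m + m) * n)) (canon s) * pairBox K (m := m) (n := n) a c) then h.choose else 1

/-- the defining property of the collapse coefficient (`m ≥ 1`, `a, c ≠ 0`). -/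
theorem ccoef_spec (hm : 1 ≤ m) {a c : K} (ha : a ≠ 0) (hc : c ≠ 0) (s : Finset (Fin ((m + m) * n))) :
    ccoef K a c s ≠ 0 ∧ B K (Fin ((m + m) * n)) s * pairBox K (m := m) (n := n) a c =
      ccoef K a c s • (B K (Fin ((m + m) * n)) (canon s) * pairBox K (m := m) (n := n) a c) := by
  have h := B_mul_pairBox_eq_smul_canon K hm ha hc s
  rw [ccoef, dif_pos h]
  exact h.choose_spec

/-- the COLLAPSE BINOMIAL of `s`: `E_s − λ_s · E_{canon s}`. -/
noncomputable def binom (a c : K) (s : Finset (Fin ((m + m) * n))) : HT K (Fin ((m + m) * n)) :=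
  B K (Fin ((m + m) * n)) s - ccoef K a c s • B K (Fin ((m + m) * n)) (canon s)

/-- **a collapse binomial is annihilated by the box**: `(E_s − λ_s E_{canon s}) ∧ F = 0`. -/
theorem binom_mul_pairBox (hm : 1 ≤ m) {a c : K} (ha : a ≠ 0) (hc : c ≠ 0) (s : Finset (Fin ((m + m) * n))) :
    binom K a c s * pairBox K (m := m) (n := n) a c = 0 := by
  rw [binom, sub_mul, smul_mul_assoc, ← (ccoef_spec K hm ha hc s).2, sub_self]

/-- a collapse binomial of a `k`-set lies in `⋀^k`. -/
lemma binom_mem_exteriorPower (a c : K) {k : ℕ} {s : Finset (Fin ((m + m) * n))} (hs : s.card = k) :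
    binom K a c s ∈ ⋀[K]^k (Fin ((m + m) * n) → K) :=
  Submodule.sub_mem _ (SurfacePowers.B_mem_exteriorPower K hs)
    (Submodule.smul_mem _ _ (SurfacePowers.B_mem_exteriorPower K (by rw [card_canon, hs])))

/-! ## §3. Killed monomials and collapse binomials are linearly independent -/

/-- **the killed monomials and the collapse binomials of the collapsed sets form a linearly independent family** (`m ≥ 1`):
the projection forgetting the canonical alive monomials sends the family to distinct basis monomials. -/
theorem linearIndependent_killed_binom (hm : 1 ≤ m) (a c : K) (k : ℕ) :
    LinearIndependent K (Sum.elim (fun s : killedSet m n k => B K (Fin ((m + m) * n)) s.1)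
      (fun s : collapsedSet m n k => binom K a c s.1)) := by
  classical
  -- the canonical alive monomials (any degree) are projected away
  let cn : Finset (Fin ((m + m) * n)) → Prop := fun t =>
    (∀ i : Fin n, Disjoint (pb m n i t) (Ys m) ∨ Disjoint (pb m n i t) (Xs m)) ∧ ∀ i : Fin n, pb m n i t ≠ Ys m
  let P : HT K (Fin ((m + m) * n)) →ₗ[K] HT K (Fin ((m + m) * n)) :=
    (B K (Fin ((m + m) * n))).constr K fun t => if cn t then (0 : HT K (Fin ((m + m) * n))) else B K (Fin ((m + m) * n)) t
  have hP : ∀ t, P (B K (Fin ((m + m) * n)) t) = if cn t then (0 : HT K (Fin ((m + m) * n))) else B K (Fin ((m + m) * n)) t :=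
    fun t => Basis.constr_basis _ _ _ _
  apply LinearIndependent.of_comp P
  have key : P ∘ Sum.elim (fun s : killedSet m n k => B K (Fin ((m + m) * n)) s.1)
      (fun s : collapsedSet m n k => binom K a c s.1) =
      fun x => B K (Fin ((m + m) * n)) (Sum.elim (fun s : killedSet m n k => s.1) (fun s : collapsedSet m n k => s.1) x) := by
    funext x
    rcases x with s | s
    · rw [Function.comp_apply, Sum.elim_inl, Sum.elim_inl, hP, if_neg]
      exact fun h => (mem_killedSet.mp s.2).2 h.1
    · rw [Function.comp_apply, Sum.elim_inr, Sum.elim_inr, binom, map_sub, map_smul, hP, hP, if_neg, if_pos, smul_zero, sub_zero]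
      · exact ⟨alive_canon (mem_collapsedSet.mp s.2).1.2, pb_canon_ne_Ys hm s.1⟩
      · exact fun h => (mem_collapsedSet.mp s.2).2 h.2
  rw [key]
  refine (B K (Fin ((m + m) * n))).linearIndependent.comp _ ?_
  rintro (s | s) (t | t) h
  · exact congr_arg Sum.inl (Subtype.ext h)
  · exact absurd (mem_collapsedSet.mp t.2).1.2 (by rw [← show s.1 = t.1 from h]; exact (mem_killedSet.mp s.2).2)
  · exact absurd (mem_collapsedSet.mp s.2).1.2 (by rw [show s.1 = t.1 from h]; exact (mem_killedSet.mp t.2).2)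
  · exact congr_arg Sum.inr (Subtype.ext h)

/-! ## §4. The kernel in every degree -/

/-- every generator lies in the kernel: killed monomials (gen 6) and collapse binomials (§2). -/
lemma span_killed_sup_span_binom_le_map_ker (hm : 1 ≤ m) {a c : K} (ha : a ≠ 0) (hc : c ≠ 0) (k : ℕ) :
    Submodule.span K (Set.range fun s : killedSet m n k => B K (Fin ((m + m) * n)) s.1) ⊔
        Submodule.span K (Set.range fun s : collapsedSet m n k => binom K a c s.1) ≤
      (LinearMap.ker (wedge K (Fin ((m + m) * n)) k (pairBox K (m := m) (n := n) a c))).map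
        (⋀[K]^k (Fin ((m + m) * n) → K)).subtype := by
  refine sup_le (span_killed_le_map_ker K hm ha hc k) ?_
  rw [Submodule.span_le]
  rintro _ ⟨⟨s, hs⟩, rfl⟩
  refine ⟨⟨binom K a c s, binom_mem_exteriorPower K a c (mem_collapsedSet.mp hs).1.1⟩, ?_, rfl⟩
  rw [SetLike.mem_coe, LinearMap.mem_ker]
  exact binom_mul_pairBox K hm ha hc s

/-- **`dim ker(θ ↦ θ ∧ F ∣ ⋀^k) = #killed + #collapsed`** for every field, `m ≥ 1`, `n`, `k`, `a, c ≠ 0` (rank–nullity: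
`rank = #classes = #canonical`, `C((m+m)n, k) = #alive + #killed`, `#alive = #canonical + #collapsed`). -/
theorem finrank_ker_wedge_pairBox_all (hm : 1 ≤ m) {a c : K} (ha : a ≠ 0) (hc : c ≠ 0) (k : ℕ) :
    finrank K (LinearMap.ker (wedge K (Fin ((m + m) * n)) k (pairBox K (m := m) (n := n) a c))) =
      (killedSet m n k).card + (collapsedSet m n k).card := by
  have h1 := LinearMap.finrank_range_add_finrank_ker (wedge K (Fin ((m + m) * n)) k (pairBox K (m := m) (n := n) a c))
  rw [finrank_range_wedge_pairBox_eq_card K hm ha hc, finrank_exteriorPower_fin,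
    ← card_aliveSet_add_card_killedSet (m := m) (n := n) k, ← card_canonSet_add_card_collapsedSet,
    ← card_canonSet_eq_card_Kset hm] at h1
  omega

/-- **MAIN THEOREM — THE KERNEL IN EVERY DEGREE, every field, `m ≥ 1`, `n`, `k`, `a, c ≠ 0`**:
`ker(θ ↦ θ ∧ F ∣ ⋀^k K^{(m+m)n}) = span{E_s : s killed} ⊔ span{E_s − λ_s·E_{canon s} : s collapsed}` (as a subspace of
`⋀ K^{(m+m)n}`; the sum is direct by §3).  ⊇ is §2 + gen 6; `=` by the dimension count `finrank_ker_wedge_pairBox_all`. -/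
theorem map_ker_wedge_pairBox_eq_span_killed_sup_binom (hm : 1 ≤ m) {a c : K} (ha : a ≠ 0) (hc : c ≠ 0) (k : ℕ) :
    (LinearMap.ker (wedge K (Fin ((m + m) * n)) k (pairBox K (m := m) (n := n) a c))).map
        (⋀[K]^k (Fin ((m + m) * n) → K)).subtype =
      Submodule.span K (Set.range fun s : killedSet m n k => B K (Fin ((m + m) * n)) s.1) ⊔
        Submodule.span K (Set.range fun s : collapsedSet m n k => binom K a c s.1) := by
  refine (Submodule.eq_of_le_of_finrank_eq (span_killed_sup_span_binom_le_map_ker K hm ha hc k) ?_).symm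
  rw [← Submodule.span_union, ← Set.Sum.elim_range, finrank_span_eq_card (linearIndependent_killed_binom K hm a c k),
    Fintype.card_sum, Fintype.card_coe, Fintype.card_coe, Submodule.finrank_map_subtype_eq,
    finrank_ker_wedge_pairBox_all K hm ha hc k]

/-! ## §5. Where the collapses live: none below degree `m`, one line per factor in degree `m` -/

/-- each block part of a `k`-set has at most `k` letters, so **below degree `m` nothing collapses** (gen 6's case). -/
theorem collapsedSet_eq_empty_of_lt {k : ℕ} (hk : k < m) : collapsedSet m n k = ∅ := by
  refine Finset.eq_empty_of_forall_notMem fun s hs => ?_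
  obtain ⟨⟨hcard, -⟩, hnot⟩ := mem_collapsedSet.mp hs
  obtain ⟨i, hi⟩ := not_forall.mp hnot
  rw [not_ne_iff] at hi
  have h1 := card_pb_le s i
  rw [hi, WedgePair.card_Yset, hcard] at h1
  omega

variable (m n)

/-- the FULL HALF `Y_i` of block `i` as a monomial support: `E_{Y_i}`. -/
def yBlock (i : Fin n) : Finset (Fin ((m + m) * n)) := glue fun j => if j = i then Ys m else ∅

variable {m n}

/-- block parts of `Y_i`. -/
lemma pb_yBlock (i j : Fin n) : pb m n j (yBlock m n i) = if j = i then Ys m else ∅ := by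
  unfold yBlock
  rw [pb_glue]

/-- `E_{Y_i}` has `m` letters. -/
lemma card_yBlock (i : Fin n) : (yBlock m n i).card = m := by
  rw [card_eq_sum_card_pb (yBlock m n i)]
  simp_rw [pb_yBlock, apply_ite Finset.card, WedgePair.card_Yset, Finset.card_empty]
  rw [Finset.sum_ite_eq' Finset.univ i, if_pos (Finset.mem_univ _)]

/-- `E_{Y_i}` is a collapsed `m`-set (`m ≥ 1`). -/
lemma yBlock_mem_collapsedSet (i : Fin n) : yBlock m n i ∈ collapsedSet m n m := by
  rw [mem_collapsedSet]
  refine ⟨⟨card_yBlock i, fun j => ?_⟩, not_forall.mpr ⟨i, by rw [pb_yBlock, if_pos rfl, not_ne_iff]⟩⟩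
  rw [pb_yBlock]
  split_ifs
  · exact Or.inr (WedgePair.disjoint_XY m).symm
  · exact Or.inl (Finset.disjoint_empty_left _)

/-- **in degree `m` the collapsed sets are exactly the `n` full halves `Y_i`**: a block part `Y_i` uses up all `m` letters. -/
theorem collapsedSet_self_eq_image : collapsedSet m n m = Finset.univ.image (yBlock m n) := by
  ext s
  rw [Finset.mem_image]
  constructor
  · intro hs
    obtain ⟨⟨hcard, -⟩, hnot⟩ := mem_collapsedSet.mp hs
    obtain ⟨i, hi⟩ := not_forall.mp hnot
    rw [not_ne_iff] at hi
    refine ⟨i, Finset.mem_univ _, (eq_of_pb_eq fun j => ?_).symm⟩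
    rw [pb_yBlock]
    split_ifs with hji
    · rw [hji, hi]
    · have hsum := card_eq_sum_card_pb s
      rw [hcard, ← Finset.add_sum_erase _ _ (Finset.mem_univ i), hi, WedgePair.card_Yset] at hsum
      have hz : (∑ x ∈ Finset.univ.erase i, (pb m n x s).card) = 0 := Nat.add_left_cancel (hsum.symm.trans (Nat.add_zero m).symm)
      exact Finset.card_eq_zero.mp (Finset.sum_eq_zero_iff.mp hz j (Finset.mem_erase.mpr ⟨hji, Finset.mem_univ j⟩))
  · rintro ⟨i, -, rfl⟩
    exact yBlock_mem_collapsedSet i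

/-- the halves `Y_i` are pairwise distinct monomials (`m ≥ 1`). -/
lemma yBlock_injective (hm : 1 ≤ m) : Function.Injective (yBlock m n) := by
  intro i j h
  by_contra hij
  have h1 := pb_yBlock (m := m) i i
  rw [h, pb_yBlock, if_pos rfl, if_neg hij] at h1
  exact absurd (congr_arg Finset.card h1) (by rw [Finset.card_empty, WedgePair.card_Yset]; omega)

/-- **there are exactly `n` collapsed sets in degree `m`** — one per factor. -/
theorem card_collapsedSet_self (hm : 1 ≤ m) : (collapsedSet m n m).card = n := by
  rw [collapsedSet_self_eq_image, Finset.card_image_of_injective _ (yBlock_injective hm), Finset.card_univ, Fintype.card_fin]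

/-- **ONE COLLAPSED LINE PER FACTOR in degree `m`**: `dim ker(θ ↦ θ ∧ F ∣ ⋀^m K^{(m+m)n}) = #killed + n`, the extra `n` kernel
vectors being the collapse binomials `E_{Y_i} − λ·E_{X_i}` (every field, `m ≥ 1`, `n`, `a, c ≠ 0`). -/
theorem finrank_ker_wedge_pairBox_self (hm : 1 ≤ m) {a c : K} (ha : a ≠ 0) (hc : c ≠ 0) :
    finrank K (LinearMap.ker (wedge K (Fin ((m + m) * n)) m (pairBox K (m := m) (n := n) a c))) =
      (killedSet m n m).card + n := by
  rw [finrank_ker_wedge_pairBox_all K hm ha hc, card_collapsedSet_self hm]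

/-- **SURFACE POWERS, degree 2 (STRUCTURE C10's kernel `5n`, NAMED)**: for `m = 2` the kernel of `θ ↦ θ ∧ F` on `⋀² K^{4n}` is made of
the `4n` SPLIT PAIRS `x ∧ y` (`x ∈ X_i`, `y ∈ Y_i`: gen 6's `killedSet_two_eq_splitPairs`, `card_splitPairs`) and the `n` COLLAPSED LINES
`y_{i1}y_{i2} − λ·x_{i1}x_{i2}`, `dim = 4n + n` (`= 5n`: `WedgePointPairPowersKernelDim.finrank_ker_wedge_pairBox_two_two`); in the quoted
dictionary «⊕_i [H¹(T_{S_i}) ⊕ collapsed line]». -/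
theorem ker_wedge_pairBox_two_surface_named {a c : K} (ha : a ≠ 0) (hc : c ≠ 0) :
    (killedSet 2 n 2).card = n * (2 * 2) ∧ (collapsedSet 2 n 2).card = n ∧
      finrank K (LinearMap.ker (wedge K (Fin ((2 + 2) * n)) 2 (pairBox K (m := 2) (n := n) a c))) = n * (2 * 2) + n := by
  refine ⟨by rw [killedSet_two_eq_splitPairs, card_splitPairs], card_collapsedSet_self (by norm_num), ?_⟩
  rw [finrank_ker_wedge_pairBox_self K (by norm_num) ha hc, killedSet_two_eq_splitPairs, card_splitPairs]

end Summit.Ventures.HSemireg.Wedge.PairPowers
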